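import Summits.PneNP.PneNP.Theses.SymmetryBudget
import Literature.Computability.Complexity.SymmetricCircuit
import Literature.Computability.Complexity.GraphCanonization

/-!
# Crux-ideate sketch — NoHiddenOrder (stmt-PneNP-14781), ideator 1, round 1

First lemmas of the two crux idea cards (statements as sorry-free `def … : Prop`, plus two
pure-logic theorems):

* shared: `Gr`, `symm`, `WindowCanonisation'` (symmetrised canonical copy, per-bit symmetric
  circuits), `not_windowBarrier_of_noHiddenOrder` (pure logic), `CanonisationGivesNoHiddenOrder`;
* card `deck-reconstruction-dp`: `ColouredKellyUlam`, `DeckDPCanonises`,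
  `windowBarrier_refutes_colouredKellyUlam`;
* card `coset-dp-tame-shelling`: `autMarked`, `Twins`, `SmallBaseModTwins`, `TameShelling`,
  `budAut`, `CosetDPCanonisesModerate`.
-/

noncomputable section

open Classical Filter
open Literature.Computability.Complexity
open Summit.PneNP.PneNP.Theses.SymmetryBudget

namespace Summit.PneNP.PneNP.Cruxes.NoHiddenOrder.IdeaSketchK1

/-- The route's reading of a Boolean matrix as a simple graph (inline `Gr` of the route file). -/
def Gr (m : ℕ) (x : Fin m × Fin m → Bool) : SimpleGraph (Fin m) :=
  SimpleGraph.fromRel fun u v => x (u, v) = true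

/-- Symmetrised, loop-free normal form `x*` of a matrix: `Gr m (symm m x) = Gr m x`, and the
slices of the crux depend on `x` only through `Gr m x`. -/
def symm (m : ℕ) (x : Fin m × Fin m → Bool) : Fin m × Fin m → Bool :=
  fun q => decide (q.1 ≠ q.2) && (x q || x (q.2, q.1))

/-- **Window canonisation (symmetrised form).** A `Bud(m,⌊log₂ m⌋)`-invariant map `κ` with
`κ x = x* ∘ (π_x × π_x)` for some `π_x ∈ Bud`, every output bit of which has a polynomial-size
`Bud`-symmetric threshold circuit. (Variant of `IdeaSketch.WindowCanonisation` of the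
WindowBarrier crux with `x` replaced by its symmetrisation `x*`; this is what both DPs produce.) -/
def WindowCanonisation' : Prop :=
  ∃ p : Polynomial ℕ, ∀ m : ℕ, ∃ κ : (Fin m × Fin m → Bool) → (Fin m × Fin m → Bool),
    (∀ x, ∃ π ∈ pointStabiliserBudget m (Nat.log 2 m), κ x = fun q => symm m x (π q.1, π q.2)) ∧
    (∀ x, ∀ ρ ∈ pointStabiliserBudget m (Nat.log 2 m),
        κ (fun q => x (ρ q.1, ρ q.2)) = κ x) ∧
    ∀ q : Fin m × Fin m,
      HasSymCircuit tcBasis (pointStabiliserBudget m (Nat.log 2 m)) (p.eval m) (fun x => κ x q)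

/-- Canonise-then-compute for the crux (provable now, as `Disproof.windowBarrierAt_false_of_
symCanonisation` / `Negative.SymmetricComposition.isSymmetricUnder_top`, plus `Gr m (symm m x)
= Gr m x`): a symmetrised window canonisation gives `NoHiddenOrder`. -/
def CanonisationGivesNoHiddenOrder : Prop :=
  WindowCanonisation' → NoHiddenOrder

/-- Pure logic: the crux is the classical dual of the route's support item `WindowBarrier`. -/
theorem not_windowBarrier_of_noHiddenOrder (h : NoHiddenOrder) : ¬ WindowBarrier := by
  rintro ⟨L, hL, hinv, hhard⟩
  obtain ⟨p, hp⟩ := h L hL hinv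
  exact (hhard p) (hp.mono fun m hm hn => hn hm)

/-! ### Card `deck-reconstruction-dp` — Kelly–Ulam dynamic programming -/

/-- **Kelly–Ulam for vertex-coloured graphs** (the Reconstruction Conjecture, coloured form):
two vertex-coloured graphs on `n + 1 ≥ 3` vertices whose coloured decks agree (a bijection `β`
between cards with `(G - p, c) ≅ (H - β p, d)` colour-preservingly; the card at `p` is the
pull-back along `Fin.succAbove p`) are colour-isomorphic. Uncoloured Kelly–Ulam is the case of
constant colourings. OPEN (conjecture; route item / conditional, never a Literature fact). -/
def ColouredKellyUlam : Prop :=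
  ∀ n : ℕ, 2 ≤ n → ∀ (G H : SimpleGraph (Fin (n + 1))) (c d : Fin (n + 1) → ℕ),
    (∃ β : Equiv.Perm (Fin (n + 1)), ∀ p : Fin (n + 1),
        ColIso n (G.comap (Fin.succAbove p)) (c ∘ Fin.succAbove p)
          (H.comap (Fin.succAbove (β p))) (d ∘ Fin.succAbove (β p))) →
      ColIso (n + 1) G c H d

/-- **The deck DP canonises the window** (card A's thesis): under coloured Kelly–Ulam, the
subset-indexed dynamic programme `CAN(S) := RECON(sort {CAN(S - v) : v ∈ S})` over the `2^g ≤ m`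
subsets of the free part — with `RECON` a hard-wired `2^{O(k)}`-size reconstruction block built
from a moderately exponential canonical form (Babai–Luks 1983, named fact) — is a polynomial-size
`Bud`-symmetric canoniser. -/
def DeckDPCanonises : Prop :=
  ColouredKellyUlam → babaiLuks1983_canonicalForm → WindowCanonisation'

/-- **Corollary (pure logic from the two lemmas above): a proof of `WindowBarrier` refutes the
coloured Reconstruction Conjecture.** -/
theorem windowBarrier_refutes_colouredKellyUlam (h₁ : DeckDPCanonises)
    (h₂ : CanonisationGivesNoHiddenOrder) (hBL : babaiLuks1983_canonicalForm)
    (hWB : WindowBarrier) : ¬ ColouredKellyUlam :=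
  fun hRC => not_windowBarrier_of_noHiddenOrder (h₂ (h₁ hRC hBL)) hWB

/-! ### Card `coset-dp-tame-shelling` — labelling-coset dynamic programming -/

/-- Automorphisms of the marked, coloured induced subgraph on `P` (marks `A i`, colours `col`),
realised as permutations of `Fin g` fixing every vertex outside `P`. -/
def autMarked {g t : ℕ} (H : SimpleGraph (Fin g)) (col : Fin g → ℕ) (A : Fin t → Finset (Fin g))
    (P : Finset (Fin g)) : Set (Equiv.Perm (Fin g)) :=
  {σ | (∀ u, u ∉ P → σ u = u) ∧ (∀ u ∈ P, σ u ∈ P) ∧ (∀ u ∈ P, col (σ u) = col u) ∧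
       (∀ i, ∀ u ∈ P, (σ u ∈ A i ↔ u ∈ A i)) ∧
       ∀ u ∈ P, ∀ v ∈ P, (H.Adj (σ u) (σ v) ↔ H.Adj u v)}

/-- Twins inside the marked coloured induced subgraph on `P` (same colour, same marks, same
neighbours in `P`); permuting twins is the symmetry the DP absorbs by counting. -/
def Twins {g t : ℕ} (H : SimpleGraph (Fin g)) (col : Fin g → ℕ) (A : Fin t → Finset (Fin g))
    (P : Finset (Fin g)) (u v : Fin g) : Prop :=
  col u = col v ∧ (∀ i, (u ∈ A i ↔ v ∈ A i)) ∧
    ∀ w ∈ P, w ≠ u → w ≠ v → (H.Adj u w ↔ H.Adj v w)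

/-- The marked induced subgraph on `P` has a BASE of size `≤ b` modulo twins: fixing `B`
pointwise forces every automorphism to move each vertex only to a twin. (Base `≤ b` ⇒ the
canonical labelling coset is faithfully stored by its profile on `b`-tuples: `g^{O(b)}` wires.) -/
def SmallBaseModTwins {g t : ℕ} (H : SimpleGraph (Fin g)) (col : Fin g → ℕ)
    (A : Fin t → Finset (Fin g)) (P : Finset (Fin g)) (b : ℕ) : Prop :=
  ∃ B : Finset (Fin g), B ⊆ P ∧ B.card ≤ b ∧
    ∀ σ ∈ autMarked H col A P, (∀ x ∈ B, σ x = x) → ∀ u ∈ P, Twins H col A P u (σ u)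

/-- **Tame shelling conjecture** `TameShelling c t K`: every vertex-coloured graph on `g`
vertices with at most `2^{K g}` colour-preserving automorphisms (the complementary regime is the
entropy-support residue EST of the WindowBarrier lines) admits `t` vertex markings and a vertex
order all of whose prefixes have a base of size `≤ c g / log g + c` modulo twins. -/
def TameShelling (c t K : ℕ) : Prop :=
  ∀ g : ℕ, ∀ (H : SimpleGraph (Fin g)) (col : Fin g → ℕ),
    Nat.card {σ : Equiv.Perm (Fin g) //
        (∀ u, col (σ u) = col u) ∧ ∀ u v, (H.Adj (σ u) (σ v) ↔ H.Adj u v)} ≤ 2 ^ (K * g) →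
      ∃ (A : Fin t → Finset (Fin g)) (ord : Equiv.Perm (Fin g)),
        ∀ j : ℕ, j ≤ g →
          SmallBaseModTwins H col A (Finset.univ.filter fun u : Fin g => (ord u : ℕ) < j)
            (c * g / Nat.log 2 g + c)

/-- The `Bud`-automorphisms of an input matrix (automorphisms of the coloured free graph:
colour = attachment to the ordered part). -/
def budAut (m : ℕ) (x : Fin m × Fin m → Bool) : Set (Equiv.Perm (Fin m)) :=
  {ρ | ρ ∈ pointStabiliserBudget m (Nat.log 2 m) ∧
       ∀ u v, ((Gr m x).Adj (ρ u) (ρ v) ↔ (Gr m x).Adj u v)}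

/-- **The labelling-coset DP canonises the moderate-symmetry regime** (card B's thesis): under
`TameShelling c t K` there are polynomial-size `Bud`-symmetric circuits, one per output bit,
that compute a symmetrised window canonisation `κ` correctly on every input whose coloured free
graph has at most `2^{K g}` automorphisms (`g = ⌊log₂ m⌋`); the remaining inputs are the EST
residue (block-homogeneous, canonised by counting). -/
def CosetDPCanonisesModerate : Prop :=
  ∀ c t K : ℕ, TameShelling c t K →
    ∃ p : Polynomial ℕ, ∀ m : ℕ, ∃ κ : (Fin m × Fin m → Bool) → (Fin m × Fin m → Bool),
      (∀ x, ∃ π ∈ pointStabiliserBudget m (Nat.log 2 m), κ x = fun q => symm m x (π q.1, π q.2)) ∧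
      (∀ x, ∀ ρ ∈ pointStabiliserBudget m (Nat.log 2 m),
          κ (fun q => x (ρ q.1, ρ q.2)) = κ x) ∧
      ∀ q : Fin m × Fin m, ∃ C : Circuit (Fin m × Fin m),
        C.IsOver tcBasis ∧ C.size ≤ p.eval m ∧
        C.IsSymmetricUnder (pointStabiliserBudget m (Nat.log 2 m)) ∧
        ∀ x, Nat.card (budAut m x) ≤ 2 ^ (K * Nat.log 2 m) → C.eval x = κ x q

end Summit.PneNP.PneNP.Cruxes.NoHiddenOrder.IdeaSketchK1
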